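import Summits.AtomisticToContinuum.FouriersLaw.Theses.OddSectorIrreversibility
import Summits.AtomisticToContinuum.FouriersLaw.Theses.PuiseuxTransferLedger
import Summits.AtomisticToContinuum.FouriersLaw.Theses.SpatialCentreManifold
import Summits.AtomisticToContinuum.FouriersLaw.Theses.ProfileLadder
import Summits.AtomisticToContinuum.FouriersLaw.Theses.JunctionLocality
import Summits.AtomisticToContinuum.FouriersLaw.Theorems.PhononMeanFreePathBoundaryKubo
import Summits.AtomisticToContinuum.FouriersLaw.Theorems.PuiseuxTransferLedgerFiniteResponseProfile

/-!
# Stub `stub_lengthMonotone` (S2) of line `comonotone-local-resistance`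
# (crux stmt-AtomisticToContinuum-9141, `OddSectorIrreversibility.BoundedResponseConverges`) — helper package

Frame (verbatim the crux's): `P = pinnedChain ω₂ lam β γ` (all four `> 0`), weak-NESS uniqueness, a steady
family `μ`, `T > 0`. At length `N` a PROFILE is any `θ : ℕ → ℝ` whose values `θ i`, `i < N`, are the limits of
the quotients `(μ_{N,T+δ/2,T-δ/2}(p_i²) - μ_{N,T,T}(p_i²))/δ` (`δ → 0`, `δ ≠ 0`), `d` is the limit of
`totalCurrent(μ_{N,T+δ/2,T-δ/2})/δ`, and the LOCAL RESISTANCE of bond `(i, i+1)` is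
`r_i^{(N)} := (θ i - θ (i+1)) · ((N-1)/d)`. The registered stub S2 ("screening of the far contact") asks for
`N₀, i₁` and a slack `η i → 0` with `r_i^{(N')} ≤ r_i^{(N)} + η i` whenever `N₀ ≤ N ≤ N'`, `i₁ ≤ i`,
`2i+2 ≤ N`. It is an `N`-UNIFORM spatial-locality statement for the time-INTEGRATED contact-to-site transfer
kernel of the anharmonic chain; the tree's cross-length locality theory
(`Theorems/BoundaryEscapeDeficitHalfChainLocality*`: common-noise light cone, window Gibbs marginals) is
finite-time only (no `N`-uniform control of the time tail), so S2 is NOT closed here.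
This file lands its reductions, each concluding S2 VERBATIM from ONE (or two) EXISTING route items:

* `stub_lengthMonotone_of_twoModeBulk` — from `PuiseuxTransferLedger.TwoModeBulk` (stmt-12111) alone:
  `|θ_N(i) - θ_N(i+1) - r d/(N-1)| ≤ C|d/(N-1)|(ϑ^i + ϑ^(N-2-i))` is RELATIVE to the current, so for `d > 0`
  it reads `|r_i^{(N)} - r| ≤ 2|C|ϑ^i` on the hot half of every chain; `η i = 4|C|ϑ^i`, no floor on `d`, no
  sign of `r` (consistent with the harmonic corner, `r = 0`). The nearest existing item.
* `stub_lengthMonotone_of_summableLayers` — from `SpatialCentreManifold.LocalFourierLaw` (stmt-13406)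
  alone: summable contact layers `a ≥ 0` give `|r_i^{(N)} - r| ≤ a_i + a_(N-2-i)`, `η i = 2a_i + 2Σ_k a_(k+i)`
  (recentring `μ_{N,T,T}(p_i²) = T` by `steadyFamily_apply_self` + `gibbs_sq_momentum`).
* `stub_lengthMonotone_of_localFourierLaw` — from `ProfileLadder.LocalFourierLaw` (stmt-12675, ABSOLUTE
  error `ε(|d|+1)/(N-1)`) AND an Ohmic floor `JunctionLocality.ConductanceLowerBound` (stmt-11749, which
  the line expects from S1 ∧ S3): `|r_i^{(N)} - 1/κ| ≤ ε(1 + 1/c)`; the tolerance-indexed thresholds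
  `b(ε), N₀(ε)` are diagonalised into one depth threshold by `exists_depth_level` (`2i+2 ≤ N ≤ N'` puts
  bond `i` in the bulk window of BOTH chains once `b ≤ i`, `N₀ ≤ 2i+2`).
* pieces: `abs_localResistance_sub_le_of_twoMode`, `abs_localResistance_sub_le_of_layers`,
  `abs_localResistance_sub_inv_le` (one-line algebra), `exists_depth_level` (bookkeeping),
  `exists_responseSequence` (the full response sequence `D_N` exists — `boundaryKubo_proof` — so that
  items quantified over `D : ℕ → ℝ` can be fed; `d = D_N` by uniqueness of limits).

All three arguments are two-sided (they bound `|r_i^{(N')} - r_i^{(N)}|`): under any of these locality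
items S2's orientation carries no extra content, because `2i+2 ≤ N` keeps the far contact of either chain
at distance `≥ i+1` from the bond. Sanity of the registered signature (no defect found): `N₀, i₁, η` depend
only on the parameters, `μ`, `T`; at `N = N'` the profiles agree on `Fin N` and `d = d'` (uniqueness of
limits), forcing `0 ≤ η i` — all slacks here are `≥ 0`; the frame is not vacuous (`NessUnique_holds`,
`finiteResponseProfile_proof`, `boundaryKubo_proof`, `positiveConductance_holds`).

No definitions, no named facts; standard axioms.
-/

noncomputable section

namespace Summit.AtomisticToContinuum.FouriersLaw.Cruxes.BoundedResponseConverges.ComonotoneLocalResistance.Stubs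

open MeasureTheory Filter Topology
open Literature.MathematicalPhysics.KineticTheory.HeatConduction
open Summit.AtomisticToContinuum.FouriersLaw.Theorems.BoundaryKubo.Negative.LoadBearing (steadyFamily_apply_self)
open Summit.AtomisticToContinuum.FouriersLaw.Theorems.PhononMeanFreePathBoundaryKubo (boundaryKubo_proof)
open Summit.AtomisticToContinuum.FouriersLaw.Theorems.IncoherentChannel.Negative.GibbsStein (gibbs_sq_momentum)

/-- **Local resistance versus local Fourier law (algebra).** If the increment of the response profile
across bond `(i, i+1)` of the `N`-chain (`N ≥ 2`) is `-d/((N-1)κ)` up to `ε(|d|+1)/(N-1)` and the response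
`d` is at least `c > 0`, then the local resistance `(θ₀ - θ₁)((N-1)/d)` is within `ε(1 + 1/c)` of `1/κ`.
[folklore] -/
theorem abs_localResistance_sub_inv_le {θ₀ θ₁ d κ ε c : ℝ} {N : ℕ} (hκ : 0 < κ) (hε : 0 ≤ ε)
    (hc : 0 < c) (hcd : c ≤ d) (hN : 2 ≤ N)
    (h : |θ₁ - θ₀ + d / (((N : ℝ) - 1) * κ)| ≤ ε * ((|d| + 1) / ((N : ℝ) - 1))) :
    |(θ₀ - θ₁) * (((N : ℝ) - 1) / d) - 1 / κ| ≤ ε * (1 + 1 / c) := by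
  have hN' : (2 : ℝ) ≤ N := by exact_mod_cast hN
  have hn : 0 < (N : ℝ) - 1 := by linarith
  have hd : 0 < d := lt_of_lt_of_le hc hcd
  have key : (θ₀ - θ₁) * (((N : ℝ) - 1) / d) - 1 / κ =
      -(θ₁ - θ₀ + d / (((N : ℝ) - 1) * κ)) * (((N : ℝ) - 1) / d) := by
    field_simp
    ring
  rw [key, abs_mul, abs_neg, abs_of_pos (div_pos hn hd)]
  calc |θ₁ - θ₀ + d / (((N : ℝ) - 1) * κ)| * (((N : ℝ) - 1) / d)
      ≤ ε * ((|d| + 1) / ((N : ℝ) - 1)) * (((N : ℝ) - 1) / d) :=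
        mul_le_mul_of_nonneg_right h (le_of_lt (div_pos hn hd))
    _ = ε * (1 + 1 / d) := by
        rw [abs_of_pos hd]
        field_simp
    _ ≤ ε * (1 + 1 / c) := by
        refine mul_le_mul_of_nonneg_left ?_ hε
        have : 1 / d ≤ 1 / c := one_div_le_one_div_of_le hc hcd
        linarith

/-- **Local resistance versus two-mode bulk (algebra).** If across bond `(i, i+1)` of the `N`-chain
(`N ≥ 2`, `2i+2 ≤ N`) `|t₀ - t₁ - r·d/(N-1)| ≤ C |d/(N-1)| (θ^i + θ^(N-2-i))` with `0 ≤ θ < 1` and `d > 0`,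
then the local resistance `(t₀ - t₁)((N-1)/d)` is within `2|C|θ^i` of `r` (the far layer `θ^(N-2-i)` is
dominated by the near one since `N-2-i ≥ i`). [folklore] -/
theorem abs_localResistance_sub_le_of_twoMode {t₀ t₁ d r C θ : ℝ} {N i : ℕ} (hθ0 : 0 ≤ θ) (hθ1 : θ < 1)
    (hd : 0 < d) (hN : 2 ≤ N) (hi : 2 * i + 2 ≤ N)
    (h : |t₀ - t₁ - r * (d / ((N : ℝ) - 1))| ≤ C * |d / ((N : ℝ) - 1)| * (θ ^ i + θ ^ (N - 2 - i))) :
    |(t₀ - t₁) * (((N : ℝ) - 1) / d) - r| ≤ 2 * |C| * θ ^ i := by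
  have hN' : (2 : ℝ) ≤ N := by exact_mod_cast hN
  have hn : 0 < (N : ℝ) - 1 := by linarith
  have hg : 0 < d / ((N : ℝ) - 1) := div_pos hd hn
  have key : (t₀ - t₁) * (((N : ℝ) - 1) / d) - r =
      (t₀ - t₁ - r * (d / ((N : ℝ) - 1))) / (d / ((N : ℝ) - 1)) := by
    field_simp
  rw [key, abs_div, abs_of_pos hg, div_le_iff₀ hg]
  rw [abs_of_pos hg] at h
  have hpow : θ ^ (N - 2 - i) ≤ θ ^ i := pow_le_pow_of_le_one hθ0 hθ1.le (by omega)
  have hsum : 0 ≤ θ ^ i + θ ^ (N - 2 - i) := by positivity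
  calc |t₀ - t₁ - r * (d / ((N : ℝ) - 1))|
      ≤ C * (d / ((N : ℝ) - 1)) * (θ ^ i + θ ^ (N - 2 - i)) := h
    _ ≤ |C| * (d / ((N : ℝ) - 1)) * (θ ^ i + θ ^ (N - 2 - i)) :=
        mul_le_mul_of_nonneg_right (mul_le_mul_of_nonneg_right (le_abs_self C) hg.le) hsum
    _ ≤ |C| * (d / ((N : ℝ) - 1)) * (θ ^ i + θ ^ i) := by gcongr
    _ = 2 * |C| * θ ^ i * (d / ((N : ℝ) - 1)) := by ring

/-- **Local resistance versus summable contact layers (algebra).** If `d = (N-1)ι` with `ι > 0`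
(`N ≥ 2`) and `|τ₁ - τ₀ + r ι| ≤ |ι| e` across bond `(i, i+1)`, then the local resistance
`(τ₀ - τ₁)((N-1)/d)` is within `e` of `r`. [folklore] -/
theorem abs_localResistance_sub_le_of_layers {τ₀ τ₁ ι r e : ℝ} {N : ℕ} (hN : 2 ≤ N) (hι : 0 < ι)
    (h : |τ₁ - τ₀ + r * ι| ≤ |ι| * e) :
    |(τ₀ - τ₁) * (((N : ℝ) - 1) / (((N : ℝ) - 1) * ι)) - r| ≤ e := by
  have hN' : (2 : ℝ) ≤ N := by exact_mod_cast hN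
  have hn : 0 < (N : ℝ) - 1 := by linarith
  have key : (τ₀ - τ₁) * (((N : ℝ) - 1) / (((N : ℝ) - 1) * ι)) - r = -(τ₁ - τ₀ + r * ι) / ι := by
    field_simp
    ring
  rw [key, abs_div, abs_neg, abs_of_pos hι, div_le_iff₀ hι]
  rw [abs_of_pos hι] at h
  linarith

/-- **Diagonal bookkeeping.** Given two threshold sequences `b, N0 : ℕ → ℕ` (think: the contact depth and
the length threshold of a tolerance `ε_k ↓ 0`), there are a depth threshold `i₁` and a level function
`lev : ℕ → ℕ` tending to `∞` such that for every depth `i ≥ i₁` both thresholds at level `lev i` are `≤ i`.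
Construction: `M k = max_{k' ≤ k} max (b k') (N0 k')` (monotone envelope), `lev i` = the largest `k ≤ i`
with `M k ≤ i`, `i₁ = M 0`. [folklore] -/
theorem exists_depth_level (b N0 : ℕ → ℕ) :
    ∃ (i₁ : ℕ) (lev : ℕ → ℕ), Tendsto lev atTop atTop ∧
      ∀ i : ℕ, i₁ ≤ i → b (lev i) ≤ i ∧ N0 (lev i) ≤ i := by
  classical
  set M : ℕ → ℕ := fun k => (Finset.range (k + 1)).sup fun k' => max (b k') (N0 k') with hM
  have hbM : ∀ k, b k ≤ M k ∧ N0 k ≤ M k := by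
    intro k
    have h : max (b k) (N0 k) ≤ M k :=
      Finset.le_sup (f := fun k' => max (b k') (N0 k')) (Finset.mem_range.2 (Nat.lt_succ_self k))
    exact ⟨le_of_max_le_left h, le_of_max_le_right h⟩
  refine ⟨M 0, fun i => Nat.findGreatest (fun k => M k ≤ i) i, ?_, ?_⟩
  · rw [tendsto_atTop_atTop]
    intro K
    refine ⟨max K (M K), fun i hi => ?_⟩
    exact Nat.le_findGreatest (P := fun k => M k ≤ i) (le_of_max_le_left hi) (le_of_max_le_right hi)
  · intro i hi
    have hspec : M (Nat.findGreatest (fun k => M k ≤ i) i) ≤ i :=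
      Nat.findGreatest_spec (P := fun k => M k ≤ i) (Nat.zero_le i) hi
    exact ⟨(hbM _).1.trans hspec, (hbM _).2.trans hspec⟩

/-- **The response sequence exists** at every `N` under weak-NESS uniqueness along a steady family, `T > 0`
(`0` at `N = 0`, no bond; the boundary Kubo value at `N = M + 1`, landed `boundaryKubo_proof`).
[cite: KunduDharNarayan2009, p. 3] -/
theorem exists_responseSequence {ω₂ lam β γ : ℝ} (hω : 0 < ω₂) (hl : 0 < lam) (hβ : 0 < β) (hγ : 0 < γ)
    (hU : ∀ (N : ℕ) (T_L T_R : ℝ), 0 < T_L → 0 < T_R → ∀ μ ν : Measure (PhaseSpace N),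
      (pinnedChain ω₂ lam β γ).IsSteadyState N T_L T_R μ →
      (pinnedChain ω₂ lam β γ).IsSteadyState N T_L T_R ν → μ = ν)
    (μ : (N : ℕ) → ℝ → ℝ → Measure (PhaseSpace N))
    (hμ : ∀ (N : ℕ) (T_L T_R : ℝ), 0 < T_L → 0 < T_R →
      (pinnedChain ω₂ lam β γ).IsSteadyState N T_L T_R (μ N T_L T_R)) {T : ℝ} (hT : 0 < T) :
    ∃ D : ℕ → ℝ, ∀ N : ℕ, Tendsto (fun δ : ℝ =>
      (pinnedChain ω₂ lam β γ).totalCurrent (μ N (T + δ / 2) (T - δ / 2)) / δ) (𝓝[≠] 0) (𝓝 (D N)) := by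
  have h : ∀ N : ℕ, ∃ DN : ℝ, Tendsto (fun δ : ℝ =>
      (pinnedChain ω₂ lam β γ).totalCurrent (μ N (T + δ / 2) (T - δ / 2)) / δ) (𝓝[≠] 0) (𝓝 DN) := by
    intro N
    cases N with
    | zero =>
      refine ⟨0, ?_⟩
      simp only [OscillatorChain.totalCurrent_zero, zero_div]
      exact tendsto_const_nhds
    | succ M => exact ⟨_, (boundaryKubo_proof ω₂ lam β γ hω hl hβ hγ hU μ hμ T hT M).2⟩
  choose D hD using h
  exact ⟨D, hD⟩

/-- **S2 (`stub_lengthMonotone`, verbatim) from `ProfileLadder.LocalFourierLaw` (stmt-12675) and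
`JunctionLocality.ConductanceLowerBound` (stmt-11749).** With the tolerance-`1/(k+1)` thresholds `b k, N0 k`
of the local Fourier law, the floor `D_N ≥ c` for `N ≥ N₁` (`d = D_N` by uniqueness of limits) and `i₁, lev`
from `exists_depth_level`: `N₀ := N₁`, `η i := 2(1 + 1/c)/(lev i + 1)`; for `i₁ ≤ i`, `2i+2 ≤ N ≤ N'` bond
`i` lies in the bulk window of both chains at level `lev i`, so both local resistances are within
`(1 + 1/c)/(lev i + 1)` of `1/κ` (`abs_localResistance_sub_inv_le`). [folklore] -/
theorem stub_lengthMonotone_of_localFourierLaw :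
    Summit.AtomisticToContinuum.FouriersLaw.Theses.ProfileLadder.LocalFourierLaw →
    Summit.AtomisticToContinuum.FouriersLaw.Theses.JunctionLocality.ConductanceLowerBound →
    ∀ ω₂ lam β γ : ℝ, 0 < ω₂ → 0 < lam → 0 < β → 0 < γ →
    (∀ (N : ℕ) (T_L T_R : ℝ), 0 < T_L → 0 < T_R →
      ∀ μ ν : MeasureTheory.Measure (Literature.MathematicalPhysics.KineticTheory.HeatConduction.PhaseSpace N),
      (Literature.MathematicalPhysics.KineticTheory.HeatConduction.pinnedChain ω₂ lam β γ).IsSteadyState N T_L T_R μ →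
      (Literature.MathematicalPhysics.KineticTheory.HeatConduction.pinnedChain ω₂ lam β γ).IsSteadyState N T_L T_R ν →
      μ = ν) →
    ∀ μ : (N : ℕ) → ℝ → ℝ →
      MeasureTheory.Measure (Literature.MathematicalPhysics.KineticTheory.HeatConduction.PhaseSpace N),
      (∀ (N : ℕ) (T_L T_R : ℝ), 0 < T_L → 0 < T_R →
        (Literature.MathematicalPhysics.KineticTheory.HeatConduction.pinnedChain ω₂ lam β γ).IsSteadyState N T_L T_R
          (μ N T_L T_R)) →
    ∀ T : ℝ, 0 < T →
      ∃ N₀ i₁ : ℕ, ∃ η : ℕ → ℝ, Filter.Tendsto η Filter.atTop (nhds (0 : ℝ)) ∧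
        ∀ (N N' : ℕ) (θ θ' : ℕ → ℝ) (d d' : ℝ), N₀ ≤ N → N ≤ N' →
          (∀ i : Fin N, Filter.Tendsto (fun δ : ℝ =>
            ((∫ x, (x.2 i) ^ 2 ∂(μ N (T + δ / 2) (T - δ / 2))) - ∫ x, (x.2 i) ^ 2 ∂(μ N T T)) / δ)
            (nhdsWithin 0 {(0 : ℝ)}ᶜ) (nhds (θ i))) →
          (∀ i : Fin N', Filter.Tendsto (fun δ : ℝ =>
            ((∫ x, (x.2 i) ^ 2 ∂(μ N' (T + δ / 2) (T - δ / 2))) - ∫ x, (x.2 i) ^ 2 ∂(μ N' T T)) / δ)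
            (nhdsWithin 0 {(0 : ℝ)}ᶜ) (nhds (θ' i))) →
          Filter.Tendsto (fun δ : ℝ =>
            (Literature.MathematicalPhysics.KineticTheory.HeatConduction.pinnedChain ω₂ lam β γ).totalCurrent
              (μ N (T + δ / 2) (T - δ / 2)) / δ) (nhdsWithin 0 {(0 : ℝ)}ᶜ) (nhds d) →
          Filter.Tendsto (fun δ : ℝ =>
            (Literature.MathematicalPhysics.KineticTheory.HeatConduction.pinnedChain ω₂ lam β γ).totalCurrent
              (μ N' (T + δ / 2) (T - δ / 2)) / δ) (nhdsWithin 0 {(0 : ℝ)}ᶜ) (nhds d') →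
          0 < d → 0 < d' →
          ∀ i : ℕ, i₁ ≤ i → 2 * i + 2 ≤ N →
            (θ' i - θ' (i + 1)) * (((N' : ℝ) - 1) / d') ≤ (θ i - θ (i + 1)) * (((N : ℝ) - 1) / d) + η i := by
  intro hLF hCLB ω₂ lam β γ hω hl hβ hγ hU μ hμ T hT
  -- the canonical response sequence and its Ohmic floor
  obtain ⟨D, hD⟩ := exists_responseSequence hω hl hβ hγ hU μ hμ hT
  obtain ⟨c, hc, N₁, hfloor⟩ := hCLB ω₂ lam β γ hω hl hβ hγ hU μ hμ T hT D hD
  -- the local Fourier law along the family, at the tolerances `1/(k+1)`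
  obtain ⟨κ, hκ, hLFμ⟩ := hLF ω₂ lam β γ hω hl hβ hγ hU T hT
  have H := fun k : ℕ => hLFμ μ hμ (1 / ((k : ℝ) + 1)) (by positivity)
  choose b N0 hbN using H
  obtain ⟨i₁, lev, hlev, hthr⟩ := exists_depth_level b N0
  refine ⟨N₁, i₁, fun i => 2 * (1 + 1 / c) * (1 / ((lev i : ℝ) + 1)), ?_, ?_⟩
  · have h := ((tendsto_one_div_add_atTop_nhds_zero_nat (𝕜 := ℝ)).comp hlev).const_mul
      (2 * (1 + 1 / c))
    rw [mul_zero] at h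
    exact h
  · intro N N' θ θ' d d' hN hNN' hθ hθ' hd hd' hdpos hd'pos i hi h2i
    obtain ⟨hb, hN0⟩ := hthr i hi
    have hdD : d = D N := tendsto_nhds_unique hd (hD N)
    have hdD' : d' = D N' := tendsto_nhds_unique hd' (hD N')
    have hcd : c ≤ d := hdD ▸ hfloor N hN
    have hcd' : c ≤ d' := hdD' ▸ hfloor N' (hN.trans hNN')
    have hiN : i + 1 < N := by omega
    have hiN' : i + 1 < N' := by omega
    have h1 : |θ (i + 1) - θ i + d / (((N : ℝ) - 1) * κ)| ≤
        1 / ((lev i : ℝ) + 1) * ((|d| + 1) / ((N : ℝ) - 1)) :=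
      hbN (lev i) N d (fun j => θ j) (by omega) hd hθ ⟨i, by omega⟩ ⟨i + 1, hiN⟩ rfl hb
        (by show i + 1 + b (lev i) + 1 ≤ N; omega)
    have h2 : |θ' (i + 1) - θ' i + d' / (((N' : ℝ) - 1) * κ)| ≤
        1 / ((lev i : ℝ) + 1) * ((|d'| + 1) / ((N' : ℝ) - 1)) :=
      hbN (lev i) N' d' (fun j => θ' j) (by omega) hd' hθ' ⟨i, by omega⟩ ⟨i + 1, hiN'⟩ rfl hb
        (by show i + 1 + b (lev i) + 1 ≤ N'; omega)
    have hε : (0 : ℝ) ≤ 1 / ((lev i : ℝ) + 1) := by positivity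
    have e1 := abs_localResistance_sub_inv_le hκ hε hc hcd (by omega : 2 ≤ N) h1
    have e2 := abs_localResistance_sub_inv_le hκ hε hc hcd' (by omega : 2 ≤ N') h2
    rw [abs_le] at e1 e2
    nlinarith [e1.1, e2.2]

/-- **S2 (`stub_lengthMonotone`, verbatim) from `PuiseuxTransferLedger.TwoModeBulk` (stmt-12111) ALONE** —
the nearest existing item: `|θ_N(i) - θ_N(i+1) - r D_N/(N-1)| ≤ C |D_N/(N-1)| (ϑ^i + ϑ^(N-2-i))` with
`N`-independent `r, ϑ ∈ [0,1), C` says `|r_i^{(N)} - r| ≤ 2|C| ϑ^i` on the hot half of EVERY chain (`d > 0`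
divides out; `abs_localResistance_sub_le_of_twoMode`), hence `N₀ = i₁ = 0`, `η i = 4|C|ϑ^i → 0`. No floor
on `D_N`, no sign of `r` (consistent with the harmonic corner, `r = 0`). [folklore] -/
theorem stub_lengthMonotone_of_twoModeBulk :
    Summit.AtomisticToContinuum.FouriersLaw.Theses.PuiseuxTransferLedger.TwoModeBulk →
    ∀ ω₂ lam β γ : ℝ, 0 < ω₂ → 0 < lam → 0 < β → 0 < γ →
    (∀ (N : ℕ) (T_L T_R : ℝ), 0 < T_L → 0 < T_R →
      ∀ μ ν : MeasureTheory.Measure (Literature.MathematicalPhysics.KineticTheory.HeatConduction.PhaseSpace N),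
      (Literature.MathematicalPhysics.KineticTheory.HeatConduction.pinnedChain ω₂ lam β γ).IsSteadyState N T_L T_R μ →
      (Literature.MathematicalPhysics.KineticTheory.HeatConduction.pinnedChain ω₂ lam β γ).IsSteadyState N T_L T_R ν →
      μ = ν) →
    ∀ μ : (N : ℕ) → ℝ → ℝ →
      MeasureTheory.Measure (Literature.MathematicalPhysics.KineticTheory.HeatConduction.PhaseSpace N),
      (∀ (N : ℕ) (T_L T_R : ℝ), 0 < T_L → 0 < T_R →
        (Literature.MathematicalPhysics.KineticTheory.HeatConduction.pinnedChain ω₂ lam β γ).IsSteadyState N T_L T_R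
          (μ N T_L T_R)) →
    ∀ T : ℝ, 0 < T →
      ∃ N₀ i₁ : ℕ, ∃ η : ℕ → ℝ, Filter.Tendsto η Filter.atTop (nhds (0 : ℝ)) ∧
        ∀ (N N' : ℕ) (θ θ' : ℕ → ℝ) (d d' : ℝ), N₀ ≤ N → N ≤ N' →
          (∀ i : Fin N, Filter.Tendsto (fun δ : ℝ =>
            ((∫ x, (x.2 i) ^ 2 ∂(μ N (T + δ / 2) (T - δ / 2))) - ∫ x, (x.2 i) ^ 2 ∂(μ N T T)) / δ)
            (nhdsWithin 0 {(0 : ℝ)}ᶜ) (nhds (θ i))) →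
          (∀ i : Fin N', Filter.Tendsto (fun δ : ℝ =>
            ((∫ x, (x.2 i) ^ 2 ∂(μ N' (T + δ / 2) (T - δ / 2))) - ∫ x, (x.2 i) ^ 2 ∂(μ N' T T)) / δ)
            (nhdsWithin 0 {(0 : ℝ)}ᶜ) (nhds (θ' i))) →
          Filter.Tendsto (fun δ : ℝ =>
            (Literature.MathematicalPhysics.KineticTheory.HeatConduction.pinnedChain ω₂ lam β γ).totalCurrent
              (μ N (T + δ / 2) (T - δ / 2)) / δ) (nhdsWithin 0 {(0 : ℝ)}ᶜ) (nhds d) →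
          Filter.Tendsto (fun δ : ℝ =>
            (Literature.MathematicalPhysics.KineticTheory.HeatConduction.pinnedChain ω₂ lam β γ).totalCurrent
              (μ N' (T + δ / 2) (T - δ / 2)) / δ) (nhdsWithin 0 {(0 : ℝ)}ᶜ) (nhds d') →
          0 < d → 0 < d' →
          ∀ i : ℕ, i₁ ≤ i → 2 * i + 2 ≤ N →
            (θ' i - θ' (i + 1)) * (((N' : ℝ) - 1) / d') ≤ (θ i - θ (i + 1)) * (((N : ℝ) - 1) / d) + η i := by
  intro h2M ω₂ lam β γ hω hl hβ hγ hU μ hμ T hT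
  obtain ⟨r, ϑ, C, hϑ0, hϑ1, H⟩ := h2M ω₂ lam β γ hω hl hβ hγ hU μ hμ T hT
  refine ⟨0, 0, fun i => 4 * |C| * ϑ ^ i, ?_, ?_⟩
  · have h := (tendsto_pow_atTop_nhds_zero_of_lt_one hϑ0 hϑ1).const_mul (4 * |C|)
    rw [mul_zero] at h
    exact h
  · intro N N' θ θ' d d' hN hNN' hθ hθ' hd hd' hdpos hd'pos i hi h2i
    have hiN : i + 1 < N := by omega
    have hiN' : i + 1 < N' := by omega
    have h1 : |θ i - θ (i + 1) - r * (d / ((N : ℝ) - 1))| ≤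
        C * |d / ((N : ℝ) - 1)| * (ϑ ^ i + ϑ ^ (N - 2 - i)) :=
      H N d (fun j => θ j) hd hθ ⟨i, by omega⟩ ⟨i + 1, hiN⟩ rfl
    have h2 : |θ' i - θ' (i + 1) - r * (d' / ((N' : ℝ) - 1))| ≤
        C * |d' / ((N' : ℝ) - 1)| * (ϑ ^ i + ϑ ^ (N' - 2 - i)) :=
      H N' d' (fun j => θ' j) hd' hθ' ⟨i, by omega⟩ ⟨i + 1, hiN'⟩ rfl
    have e1 := abs_localResistance_sub_le_of_twoMode hϑ0 hϑ1 hdpos (by omega) h2i h1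
    have e2 := abs_localResistance_sub_le_of_twoMode hϑ0 hϑ1 hd'pos (by omega) (by omega) h2
    rw [abs_le] at e1 e2
    nlinarith [e1.1, e2.2, abs_nonneg C, pow_nonneg hϑ0 i]

/-- **S2 (`stub_lengthMonotone`, verbatim) from `SpatialCentreManifold.LocalFourierLaw` (stmt-13406) ALONE**:
`|τ_N(i+1) - τ_N(i) + r ι_N| ≤ |ι_N| (a_i + a_(N-2-i))`, `a ≥ 0` summable, `D_N = (N-1)ι_N` (`τ_N`, recentred at
`T`, is the same profile: `μ_{N,T,T}` is Gibbs, `steadyFamily_apply_self` + `gibbs_sq_momentum`) gives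
`|r_i^{(N)} - r| ≤ a_i + a_(N-2-i)` (`abs_localResistance_sub_le_of_layers`) and `a_(N-2-i) ≤ A_i := Σ_k a_(k+i)
→ 0` for `2i+2 ≤ N`: `N₀ = i₁ = 0`, `η i = 2 a_i + 2 A_i`. [folklore] -/
theorem stub_lengthMonotone_of_summableLayers :
    Summit.AtomisticToContinuum.FouriersLaw.Theses.SpatialCentreManifold.LocalFourierLaw →
    ∀ ω₂ lam β γ : ℝ, 0 < ω₂ → 0 < lam → 0 < β → 0 < γ →
    (∀ (N : ℕ) (T_L T_R : ℝ), 0 < T_L → 0 < T_R →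
      ∀ μ ν : MeasureTheory.Measure (Literature.MathematicalPhysics.KineticTheory.HeatConduction.PhaseSpace N),
      (Literature.MathematicalPhysics.KineticTheory.HeatConduction.pinnedChain ω₂ lam β γ).IsSteadyState N T_L T_R μ →
      (Literature.MathematicalPhysics.KineticTheory.HeatConduction.pinnedChain ω₂ lam β γ).IsSteadyState N T_L T_R ν →
      μ = ν) →
    ∀ μ : (N : ℕ) → ℝ → ℝ →
      MeasureTheory.Measure (Literature.MathematicalPhysics.KineticTheory.HeatConduction.PhaseSpace N),
      (∀ (N : ℕ) (T_L T_R : ℝ), 0 < T_L → 0 < T_R →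
        (Literature.MathematicalPhysics.KineticTheory.HeatConduction.pinnedChain ω₂ lam β γ).IsSteadyState N T_L T_R
          (μ N T_L T_R)) →
    ∀ T : ℝ, 0 < T →
      ∃ N₀ i₁ : ℕ, ∃ η : ℕ → ℝ, Filter.Tendsto η Filter.atTop (nhds (0 : ℝ)) ∧
        ∀ (N N' : ℕ) (θ θ' : ℕ → ℝ) (d d' : ℝ), N₀ ≤ N → N ≤ N' →
          (∀ i : Fin N, Filter.Tendsto (fun δ : ℝ =>
            ((∫ x, (x.2 i) ^ 2 ∂(μ N (T + δ / 2) (T - δ / 2))) - ∫ x, (x.2 i) ^ 2 ∂(μ N T T)) / δ)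
            (nhdsWithin 0 {(0 : ℝ)}ᶜ) (nhds (θ i))) →
          (∀ i : Fin N', Filter.Tendsto (fun δ : ℝ =>
            ((∫ x, (x.2 i) ^ 2 ∂(μ N' (T + δ / 2) (T - δ / 2))) - ∫ x, (x.2 i) ^ 2 ∂(μ N' T T)) / δ)
            (nhdsWithin 0 {(0 : ℝ)}ᶜ) (nhds (θ' i))) →
          Filter.Tendsto (fun δ : ℝ =>
            (Literature.MathematicalPhysics.KineticTheory.HeatConduction.pinnedChain ω₂ lam β γ).totalCurrent
              (μ N (T + δ / 2) (T - δ / 2)) / δ) (nhdsWithin 0 {(0 : ℝ)}ᶜ) (nhds d) →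
          Filter.Tendsto (fun δ : ℝ =>
            (Literature.MathematicalPhysics.KineticTheory.HeatConduction.pinnedChain ω₂ lam β γ).totalCurrent
              (μ N' (T + δ / 2) (T - δ / 2)) / δ) (nhdsWithin 0 {(0 : ℝ)}ᶜ) (nhds d') →
          0 < d → 0 < d' →
          ∀ i : ℕ, i₁ ≤ i → 2 * i + 2 ≤ N →
            (θ' i - θ' (i + 1)) * (((N' : ℝ) - 1) / d') ≤ (θ i - θ (i + 1)) * (((N : ℝ) - 1) / d) + η i := by
  intro hSC ω₂ lam β γ hω hl hβ hγ hU μ hμ T hT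
  obtain ⟨r, -, a, ha0, hasum, H⟩ := hSC ω₂ lam β γ hω hl hβ hγ hU T hT
  have Hμ := H μ hμ
  -- the tail envelope of the layer profile
  set A : ℕ → ℝ := fun i => ∑' k, a (k + i) with hA
  have hAt : Tendsto A atTop (𝓝 0) := tendsto_sum_nat_add a
  have haA : ∀ i m : ℕ, i ≤ m → a m ≤ A i := by
    intro i m him
    have hs : Summable (fun k => a (k + i)) := (summable_nat_add_iff i).2 hasum
    have h := hs.le_tsum (m - i) (fun j _ => ha0 (j + i))
    rwa [Nat.sub_add_cancel him] at h
  -- the baseline `μ_{N,T,T}(p_k²) = T`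
  have hTT : ∀ (M : ℕ) (k : Fin M), ∫ x, (x.2 k) ^ 2 ∂(μ M T T) = T := fun M k => by
    rw [steadyFamily_apply_self hω hl hβ hU hμ hT M]
    exact gibbs_sq_momentum hω hl.le hβ.le hT k
  refine ⟨0, 0, fun i => 2 * a i + 2 * A i, ?_, ?_⟩
  · have h := (hasum.tendsto_atTop_zero.const_mul 2).add (hAt.const_mul 2)
    rw [mul_zero, add_zero] at h
    exact h
  · intro N N' θ θ' d d' hN hNN' hθ hθ' hd hd' hdpos hd'pos i hi h2i
    obtain ⟨ι, τ, hι, hτ, hb⟩ := Hμ N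
    obtain ⟨ι', τ', hι', hτ', hb'⟩ := Hμ N'
    have hiN : i + 1 < N := by omega
    have hiN' : i + 1 < N' := by omega
    have hN2 : (2 : ℝ) ≤ N := by exact_mod_cast (show 2 ≤ N by omega)
    have hN2' : (2 : ℝ) ≤ N' := by exact_mod_cast (show 2 ≤ N' by omega)
    -- identification of the response objects (uniqueness of limits)
    have hdι : d = ((N : ℝ) - 1) * ι := tendsto_nhds_unique hd hι
    have hdι' : d' = ((N' : ℝ) - 1) * ι' := tendsto_nhds_unique hd' hι'
    have hιpos : 0 < ι := pos_of_mul_pos_right (hdι ▸ hdpos) (by linarith)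
    have hι'pos : 0 < ι' := pos_of_mul_pos_right (hdι' ▸ hd'pos) (by linarith)
    have hθτ : ∀ k : Fin N, θ k = τ k := fun k =>
      tendsto_nhds_unique (hθ k) ((hτ k).congr' (Eventually.of_forall fun δ => by rw [hTT N k]))
    have hθτ' : ∀ k : Fin N', θ' k = τ' k := fun k =>
      tendsto_nhds_unique (hθ' k) ((hτ' k).congr' (Eventually.of_forall fun δ => by rw [hTT N' k]))
    have e0 : θ i = τ ⟨i, by omega⟩ := hθτ ⟨i, by omega⟩
    have e1 : θ (i + 1) = τ ⟨i + 1, hiN⟩ := hθτ ⟨i + 1, hiN⟩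
    have e0' : θ' i = τ' ⟨i, by omega⟩ := hθτ' ⟨i, by omega⟩
    have e1' : θ' (i + 1) = τ' ⟨i + 1, hiN'⟩ := hθτ' ⟨i + 1, hiN'⟩
    -- the layer bounds at bond `(i, i+1)` in both chains
    have b1 : |τ ⟨i + 1, hiN⟩ - τ ⟨i, by omega⟩ + r * ι| ≤ |ι| * (a i + a (N - 1 - (i + 1))) :=
      hb ⟨i, by omega⟩ ⟨i + 1, hiN⟩ rfl
    have b2 : |τ' ⟨i + 1, hiN'⟩ - τ' ⟨i, by omega⟩ + r * ι'| ≤ |ι'| * (a i + a (N' - 1 - (i + 1))) :=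
      hb' ⟨i, by omega⟩ ⟨i + 1, hiN'⟩ rfl
    have f1 := abs_localResistance_sub_le_of_layers (show 2 ≤ N by omega) hιpos b1
    have f2 := abs_localResistance_sub_le_of_layers (show 2 ≤ N' by omega) hι'pos b2
    have g1 : a (N - 1 - (i + 1)) ≤ A i := haA i _ (by omega)
    have g2 : a (N' - 1 - (i + 1)) ≤ A i := haA i _ (by omega)
    rw [e0, e1, e0', e1', hdι, hdι']
    rw [abs_le] at f1 f2
    linarith [f1.1, f2.2]

end Summit.AtomisticToContinuum.FouriersLaw.Cruxes.BoundedResponseConverges.ComonotoneLocalResistance.Stubs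

end
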